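import Summits.ValiantsHypothesis.ValiantsHypothesis.Cruxes.NNLinearDegreeCofactorHard.Lines.xc_division

/-! # The off-diagonal shadow sieve for COR-VIRTUAL enemies (val-idea-41 g3, W6-R1 head start; crux `FifoMatching.NNDivisionHard`,
stmt-ValiantsHypothesis-21181)

W6-R1 (b142) asks for a realizable located ENEMY of the located-pencil law C⁺ = `LocatedPencilLaw` — ultimately of
COR-VIRTUAL `CorVirtualHardN`: a budgeted passenger `Q` with `xc(COR(n) + Q)` small — or kernel NEGATIVE lemmas constraining
such enemies.  This file is a negative lemma of the second kind, a SIEVE on the coordinate shadow of `Q`: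

★ `offDiagShadow_three_pow_le` — **if `Q` is CONSTANT on the off-diagonal coordinates of a principal minor `A × A`
(`OffDiagConst A Q`; all other coordinates of `Q` — the diagonal, everything outside `A × A` — are free), then every extended
formulation of `COR(n) + Q` has size `r` with `3^{|A|-1} ≤ (r + 1) · 2^{|A|-1}`.**

So an enemy of COR-VIRTUAL with `r + 1 < 1.5^{m-1}` must be NON-CONSTANT on the off-diagonal part of EVERY principal minor of
size `m` (reading for the hunt: with the quasi-polynomial budget `T c n`, on every minor of size `≳ log_{3/2} T c n`).  The
boosted cubes `Q♮` (val-idea-39), `Q∘` (✓ p674104) and `Q^c` (`BlindConstDiag41.lean`) pass the sieve (their off-diagonal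
entries move with `P` everywhere); every DIAGONAL passenger fails it with `A = univ` — in particular the permutahedral
passenger `Q^Π = conv{-diag(π) : π ∈ S_n}` (`xc = O(n log n)`), which passes every located-face test of `LocatedFace41.lean`
and the single-column negative tilt test N20 by self-similarity (all its located faces are products of sub-permutahedra), is
NOT an enemy of COR-VIRTUAL (`permPassenger_three_pow_le`).  Whether `Q^Π` nevertheless refutes the clique-row-cored law C⁺
(i.e. whether `rank₊[(1 - |a ∩ b|)² + λ · inv(a; π)]` is polynomial, `inv(a; π) = #{(l ∈ a, l' ∉ a) : π(l') < π(l)}`) is left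
OPEN here; if it does, C⁺ is the wrong research statement while COR-VIRTUAL stands.

CREDIT / PRIOR ART IN THE TREE.  The case `A = univ` («no diagonal passenger helps») is PROP D₀
`XcDivision.corPolytope_succ_add_diag_three_pow_le` of `Lines/xc_division.lean` §5c, with the same certificate — the ANCHORED
clique rows `x_{i₀} Σ_{i∈a} x_i − Σ_{i<j∈a} x_i x_j ≤ 1` (anchor `i₀`, `a ∌ i₀`), which read no diagonal entry, have slack
`(k-1)(k-2)/2` (`k = |a ∩ b|`) on the vertices `b ∋ i₀`, and hence carry the unique-disjointness pattern.  What is added here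
is only the LOCALISATION to a minor (general anchor `i₀ ∈ A`, rows `a ⊆ A ∖ i₀`, passenger free outside the off-diagonal part
of `A × A`: the anchored rows are blind to everything they do not read, `shRow_congr`), i.e. the sieve form needed by the enemy
hunt, and the engine is `XcDivision.three_pow_le_of_hits` with the one-point hitting family.

Nothing here proves or refutes the crux; VP ≠ VNP is NOT proved. -/

set_option linter.dupNamespace false

namespace Summit.ValiantsHypothesis.ValiantsHypothesis.Cruxes.NNDivisionHard.OffDiagShadow41

open Matrix Finset
open Literature.Barriers.PneNP (HasEFOfSize)
open Literature.Combinatorics.Optimization.FixedSizePsdRank (corPolytope flat vecOuter flat_dotProduct_vecOuter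
  flat_dotProduct_le_of_mem_corPolytope)
open Summit.ValiantsHypothesis.ValiantsHypothesis.Cruxes.NNLinearDegreeCofactorHard.XcDivision
  (udPt udInd ud_data udInd_apply udInd_sq udInd_inter flat_dotProduct_apply three_pow_le_of_hits
    corPolytope_succ_add_diag_three_pow_le)
open scoped Pointwise

variable {n : ℕ}

/-- the matrix coordinate `(i, k)` of a flattened vector. -/
def coord (i k : Fin n) (y : Fin (n * n) → ℝ) : ℝ := y (finProdFinEquiv (i, k))

theorem coord_flat (i k : Fin n) (S : Matrix (Fin n) (Fin n) ℝ) : coord i k (flat S) = S i k := by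
  simp [coord, flat]

theorem coord_add (i k : Fin n) (y y' : Fin (n * n) → ℝ) : coord i k (y + y') = coord i k y + coord i k y' := rfl

/-- `Q` is CONSTANT on the off-diagonal coordinates of the principal minor `A × A`. -/
def OffDiagConst (A : Finset (Fin n)) (Q : Set (Fin (n * n) → ℝ)) : Prop :=
  ∀ y ∈ Q, ∀ y' ∈ Q, ∀ i ∈ A, ∀ k ∈ A, i ≠ k → coord i k y = coord i k y'

theorem OffDiagConst.mono {A B : Finset (Fin n)} {Q : Set (Fin (n * n) → ℝ)} (h : OffDiagConst B Q) (hAB : A ⊆ B) :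
    OffDiagConst A Q :=
  fun y hy y' hy' i hi k hk hik => h y hy y' hy' i (hAB hi) k (hAB hk) hik

/-! ## §1 The anchored clique rows with a general anchor -/

/-- the anchored clique matrix with anchor `i₀` and set `a`: quadratic form
`x_{i₀} Σ_{i∈a} x_i − ½ (Σ_{i∈a} x_i)² + ½ Σ_{i∈a} x_i²` (general-anchor version of `XcDivision.anMat`; zero diagonal when
`i₀ ∉ a`). -/
noncomputable def shMat (i₀ : Fin n) (a : Finset (Fin n)) : Matrix (Fin n) (Fin n) ℝ := fun i j =>
  (if i = i₀ then udInd a j else 0) -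
    (1 / 2) * (udInd a i * udInd a j - (if i = j then udInd a i else 0))

/-- the anchored quadratic form in closed form (verbatim the proof of `XcDivision.anMat_quad`). -/
theorem shMat_quad (i₀ : Fin n) (a : Finset (Fin n)) (x : Fin n → ℝ) :
    ∑ i, ∑ j, shMat i₀ a i j * (x i * x j) =
      x i₀ * (∑ j, udInd a j * x j) -
        (1 / 2) * ((∑ j, udInd a j * x j) * (∑ j, udInd a j * x j) - ∑ j, udInd a j * (x j * x j)) := by
  have h1 : ∀ i, ∑ j, shMat i₀ a i j * (x i * x j) =
      (if i = i₀ then x i * ∑ j, udInd a j * x j else 0) -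
        (1 / 2) * (udInd a i * x i * ∑ j, udInd a j * x j - udInd a i * (x i * x i)) := by
    intro i
    have : ∀ j, shMat i₀ a i j * (x i * x j) =
        (if i = i₀ then x i * (udInd a j * x j) else 0) -
          (1 / 2) * (udInd a i * x i * (udInd a j * x j) -
            (if i = j then udInd a i * (x i * x j) else 0)) := by
      intro j
      simp only [shMat]
      split_ifs <;> ring
    simp only [this, Finset.sum_sub_distrib, ← Finset.mul_sum, Finset.sum_ite_eq, Finset.mem_univ,
      if_true]
    split_ifs <;> simp [Finset.mul_sum]
  simp only [h1, Finset.sum_sub_distrib, ← Finset.mul_sum, Finset.sum_ite_eq', Finset.mem_univ, if_true,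
    ← Finset.sum_mul]

/-- the anchored matrix is supported on `{i₀} × a ∪ {(i, j) ∈ a × a : i ≠ j}`. -/
theorem shMat_eq_zero {i₀ : Fin n} {a : Finset (Fin n)} {i j : Fin n} (h1 : ¬ (i = i₀ ∧ j ∈ a))
    (h2 : ¬ (i ∈ a ∧ j ∈ a ∧ i ≠ j)) : shMat i₀ a i j = 0 := by
  simp only [shMat]
  by_cases hj : j ∈ a
  · have hi : i ≠ i₀ := fun h => h1 ⟨h, hj⟩
    rw [if_neg hi]
    by_cases hia : i ∈ a
    · have hij : i = j := by
        by_contra h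
        exact h2 ⟨hia, hj, h⟩
      subst hij
      rw [if_pos rfl, udInd_sq]; ring
    · have h0 : udInd a i = 0 := by rw [udInd_apply, if_neg hia]
      rw [h0]; split_ifs <;> ring
  · have h0 : udInd a j = 0 := by rw [udInd_apply, if_neg hj]
    by_cases hij : i = j
    · subst hij
      rw [h0]; split_ifs <;> ring
    · rw [if_neg hij, h0]; split_ifs <;> ring

/-- ★ the anchored rows inside the minor `A` (anchor `i₀ ∈ A`, `a ⊆ A ∖ i₀`) read ONLY off-diagonal coordinates of `A × A`:
two vectors that agree there have the same row value. -/
theorem shRow_congr (i₀ : Fin n) {a A : Finset (Fin n)} (hi₀ : i₀ ∈ A) (ha : a ⊆ A) (hia : i₀ ∉ a)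
    {y y' : Fin (n * n) → ℝ} (h : ∀ i ∈ A, ∀ k ∈ A, i ≠ k → coord i k y = coord i k y') :
    flat (shMat i₀ a) ⬝ᵥ y = flat (shMat i₀ a) ⬝ᵥ y' := by
  rw [flat_dotProduct_apply, flat_dotProduct_apply]
  refine Finset.sum_congr rfl fun i _ => Finset.sum_congr rfl fun k _ => ?_
  by_cases h1 : i = i₀ ∧ k ∈ a
  · obtain ⟨rfl, hk⟩ := h1
    have hik : i ≠ k := fun e => hia (e ▸ hk)
    exact congrArg (shMat i a i k * ·) (h i hi₀ k (ha hk) hik)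
  · by_cases h2 : i ∈ a ∧ k ∈ a ∧ i ≠ k
    · exact congrArg (shMat i₀ a i k * ·) (h i (ha h2.1) k (ha h2.2.1) h2.2.2)
    · rw [shMat_eq_zero h1 h2, zero_mul, zero_mul]

/-- the anchored rows are valid on `COR(n)`: on a `0/1` point the form is `x_{i₀} k − (k² − k)/2 ≤ 1`, `k ∈ ℕ`
(verbatim the proof inside `XcDivision.corPolytope_succ_add_diag_three_pow_le`). -/
theorem shRow_valid (i₀ : Fin n) (a : Finset (Fin n)) : ∀ y ∈ corPolytope n, flat (shMat i₀ a) ⬝ᵥ y ≤ 1 := by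
  classical
  have valid01 : ∀ x : Fin n → ℝ, (∀ i, x i = 0 ∨ x i = 1) → ∑ i, ∑ j, shMat i₀ a i j * (x i * x j) ≤ 1 := by
    intro x hx
    rw [shMat_quad]
    have hxx : ∀ j, x j * x j = x j := fun j => by rcases hx j with h0 | h0 <;> simp [h0]
    simp only [hxx]
    obtain ⟨k, hk⟩ : ∃ k : ℕ, ∑ j, udInd a j * x j = k := by
      refine ⟨(Finset.univ.filter fun j => j ∈ a ∧ x j = 1).card, ?_⟩
      rw [← Finset.sum_boole]
      refine Finset.sum_congr rfl fun j _ => ?_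
      rw [udInd_apply]
      rcases hx j with h0 | h0 <;> by_cases hj : j ∈ a <;> simp [h0, hj]
    rw [hk]
    have hkk : ((k : ℝ) - 1) * ((k : ℝ) - 2) ≥ 0 := by
      rcases Nat.lt_or_ge k 2 with hk2 | hk2
      · interval_cases k <;> norm_num
      · have : (2 : ℝ) ≤ k := by exact_mod_cast hk2
        nlinarith
    have hk0 : (0 : ℝ) ≤ k := Nat.cast_nonneg k
    rcases hx i₀ with h0 | h0 <;> rw [h0] <;> nlinarith
  intro y hy
  exact flat_dotProduct_le_of_mem_corPolytope hy ⟨(shMat i₀ a, 1), fun x hx => valid01 x hx⟩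

/-! ## §2 ★ The off-diagonal shadow sieve -/

/-- ★★ **THE OFF-DIAGONAL SHADOW SIEVE.**  If the passenger `Q` (nonempty, otherwise arbitrary: any dimension, any number of
vertices, any extension complexity) is CONSTANT on the off-diagonal coordinates of the principal minor `A × A`, then
`3^{|A|-1} ≤ (r + 1) · 2^{|A|-1}` for every extended formulation of size `r` of `COR(n) + Q`.  Certificate: the anchored
clique rows of §1 inside `A` (anchor `i₀ ∈ A`), to which `Q` is a constant; their slack at `udPt ({i₀} ∪ b) + y₀` is
`(|a ∩ b| − 1)(|a ∩ b| − 2)/2` — one on disjoint pairs, zero at `|a ∩ b| = 1` — and `XcDivision.three_pow_le_of_hits`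
(Yannakakis + Kaibel–Weltge) on the ground set `A ∖ i₀`. -/
theorem offDiagShadow_three_pow_le {r : ℕ} {Q : Set (Fin (n * n) → ℝ)}
    (h : HasEFOfSize (corPolytope n + Q) r) (hQne : Q.Nonempty) (A : Finset (Fin n)) (hQ : OffDiagConst A Q) :
    3 ^ (A.card - 1) ≤ (r + 1) * 2 ^ (A.card - 1) := by
  classical
  obtain ⟨y₀, hy₀⟩ := hQne
  rcases A.eq_empty_or_nonempty with rfl | ⟨i₀, hi₀⟩
  · simp
  obtain ⟨pt_mem, -, -, -⟩ := ud_data n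
  set A' : Finset (Fin n) := A.erase i₀ with hA'
  let e : ↥A' ↪ Fin n := Function.Embedding.subtype (· ∈ A')
  let rowOf : Finset ↥A' → Finset (Fin n) := fun a' => a'.map e
  let colOf : Finset ↥A' → Finset (Fin n) := fun b' => insert i₀ (b'.map e)
  have hrow_sub : ∀ a', rowOf a' ⊆ A := by
    intro a' x hx
    obtain ⟨x', -, rfl⟩ := Finset.mem_map.1 hx
    exact Finset.mem_of_mem_erase x'.2
  have hrow_i₀ : ∀ a', i₀ ∉ rowOf a' := by
    intro a' hx
    obtain ⟨x', -, hx'⟩ := Finset.mem_map.1 hx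
    exact (Finset.ne_of_mem_erase x'.2) hx'
  have hAB : ∀ a' b', (rowOf a' ∩ colOf b').card = (a' ∩ b').card := by
    intro a' b'
    have : rowOf a' ∩ colOf b' = (a' ∩ b').map e := by
      show a'.map e ∩ insert i₀ (b'.map e) = _
      rw [Finset.inter_insert_of_notMem (hrow_i₀ a'), Finset.map_inter]
    rw [this, Finset.card_map]
  have hsum : ∀ a' b', ∑ j, udInd (rowOf a') j * udInd (colOf b') j = ((a' ∩ b').card : ℝ) := by
    intro a' b'; rw [udInd_inter, hAB]
  have hsq : ∀ (a' : Finset ↥A') (b : Finset (Fin n)),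
      ∑ j, udInd (rowOf a') j * (udInd b j * udInd b j) = ∑ j, udInd (rowOf a') j * udInd b j := by
    intro a' b; simp only [udInd_sq]
  have hzB : ∀ b', udInd (colOf b') i₀ = 1 := by
    intro b'; rw [udInd_apply, if_pos (Finset.mem_insert_self _ _)]
  -- slack of the anchored row at the column point: `(k-1)(k-2)/2`
  have slack : ∀ a' b', 1 - flat (shMat i₀ (rowOf a')) ⬝ᵥ udPt (colOf b') =
      (((a' ∩ b').card : ℝ) - 1) * (((a' ∩ b').card : ℝ) - 2) / 2 := by
    intro a' b'
    show 1 - flat (shMat i₀ (rowOf a')) ⬝ᵥ vecOuter n (udInd (colOf b')) = _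
    rw [flat_dotProduct_vecOuter, shMat_quad, hsq, hsum, hzB]
    ring
  -- `Q` is a constant to the anchored rows inside `A`: `y₀` is a (trivial) common maximiser
  have blind : ∀ a', ∀ y ∈ Q, flat (shMat i₀ (rowOf a')) ⬝ᵥ y ≤ flat (shMat i₀ (rowOf a')) ⬝ᵥ y₀ :=
    fun a' y hy => (shRow_congr i₀ hi₀ (hrow_sub a') (hrow_i₀ a') (hQ y hy y₀ hy₀)).le
  have key := three_pow_le_of_hits h (fun b' => udPt (colOf b')) (fun b' => pt_mem _)
    (fun a' => flat (shMat i₀ (rowOf a'))) (fun _ => 1) (fun a' => shRow_valid i₀ (rowOf a')) ?_ ?_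
    (fun _ : Unit => y₀) (fun _ => hy₀) (fun a' => ⟨(), blind a'⟩)
  · have hcard : Fintype.card ↥A' = A.card - 1 := by
      rw [Fintype.card_coe, hA', Finset.card_erase_of_mem hi₀]
    rw [hcard] at key
    simpa using key
  · intro a' b' hlt hone
    have := slack a' b'
    rw [hone] at this
    norm_num at this
    linarith
  · intro a' b' hab
    have := slack a' b'
    rw [Finset.disjoint_iff_inter_eq_empty.1 hab, Finset.card_empty] at this
    norm_num at this
    linarith

/-- exponential form: `(3/2)^{|A|-1} ≤ r + 1`. -/
theorem offDiagShadow_xc_ge {r : ℕ} {Q : Set (Fin (n * n) → ℝ)}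
    (h : HasEFOfSize (corPolytope n + Q) r) (hQne : Q.Nonempty) (A : Finset (Fin n)) (hQ : OffDiagConst A Q) :
    (3 / 2 : ℝ) ^ (A.card - 1) ≤ r + 1 := by
  have h3 := offDiagShadow_three_pow_le h hQne A hQ
  have h2 : (0 : ℝ) < 2 ^ (A.card - 1) := by positivity
  rw [div_pow, div_le_iff₀ h2]
  exact_mod_cast h3

/-- ★ **THE SIEVE, contrapositive reading**: a passenger admitting an extended formulation of `COR(n) + Q` of size `r` with
`(r + 1) · 2^{m-1} < 3^{m-1}` is NON-CONSTANT on the off-diagonal part of EVERY principal minor of size `m`. -/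
theorem enemy_offDiag_nonconst {r m : ℕ} {Q : Set (Fin (n * n) → ℝ)}
    (h : HasEFOfSize (corPolytope n + Q) r) (hQne : Q.Nonempty) (hr : (r + 1) * 2 ^ (m - 1) < 3 ^ (m - 1))
    (A : Finset (Fin n)) (hA : A.card = m) :
    ∃ y ∈ Q, ∃ y' ∈ Q, ∃ i ∈ A, ∃ k ∈ A, i ≠ k ∧ coord i k y ≠ coord i k y' := by
  by_contra hc
  push Not at hc
  have hQ : OffDiagConst A Q := fun y hy y' hy' i hi k hk hik => hc y hy y' hy' i hi k hk hik
  have := offDiagShadow_three_pow_le h hQne A hQ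
  rw [hA] at this
  omega

/-! ## §3 Instances: the whole-matrix case (PROP D₀ recovered) and the permutahedral passenger -/

/-- `A = univ`: passengers constant off the diagonal (e.g. all DIAGONAL passengers) give `3^{n-1} ≤ (r+1)·2^{n-1}`
(= PROP D₀ `XcDivision.corPolytope_succ_add_diag_three_pow_le` for `n = m + 1`). -/
theorem offDiagConst_univ_three_pow_le {r : ℕ} {Q : Set (Fin (n * n) → ℝ)}
    (h : HasEFOfSize (corPolytope n + Q) r) (hQne : Q.Nonempty) (hQ : OffDiagConst Finset.univ Q) :
    3 ^ (n - 1) ≤ (r + 1) * 2 ^ (n - 1) := by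
  have := offDiagShadow_three_pow_le h hQne Finset.univ hQ
  rwa [Finset.card_univ, Fintype.card_fin] at this

/-- diagonal passengers `Q ⊆ y₀ + {diagonal matrices}` are constant off the diagonal. -/
theorem offDiagConst_of_diag {Q : Set (Fin (n * n) → ℝ)} {y₀ : Fin (n * n) → ℝ}
    (hQ : ∀ y ∈ Q, ∃ σ : Fin n → ℝ, y = y₀ + flat (Matrix.diagonal σ)) (A : Finset (Fin n)) :
    OffDiagConst A Q := by
  intro y hy y' hy' i _ k _ hik
  obtain ⟨σ, rfl⟩ := hQ y hy
  obtain ⟨σ', rfl⟩ := hQ y' hy'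
  rw [coord_add, coord_add, coord_flat, coord_flat, Matrix.diagonal_apply_ne _ hik, Matrix.diagonal_apply_ne _ hik]

/-- PROP D₀ recovered from the sieve (consistency check; one index weaker in form only: `n - 1` for `COR(n)`). -/
theorem diagPassenger_three_pow_le {r : ℕ} {Q : Set (Fin (n * n) → ℝ)}
    (h : HasEFOfSize (corPolytope n + Q) r) {y₀ : Fin (n * n) → ℝ} (hy₀ : y₀ ∈ Q)
    (hQ : ∀ y ∈ Q, ∃ σ : Fin n → ℝ, y = y₀ + flat (Matrix.diagonal σ)) :
    3 ^ (n - 1) ≤ (r + 1) * 2 ^ (n - 1) :=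
  offDiagConst_univ_three_pow_le h ⟨y₀, hy₀⟩ (offDiagConst_of_diag hQ Finset.univ)

/-- the PERMUTAHEDRAL diagonal passenger `Q^Π = conv{-diag(π) : π ∈ S_n}` (generators; `xc(Q^Π) = O(n log n)`). -/
noncomputable def permPt (π : Equiv.Perm (Fin n)) : Fin (n * n) → ℝ := flat (Matrix.diagonal fun i => -((π i : ℕ) : ℝ))

/-- ★ `Q^Π` is NOT an enemy of COR-VIRTUAL: `3^{n-1} ≤ (r+1)·2^{n-1}` for every EF of size `r` of `COR(n) + Q^Π` — although
`Q^Π` passes every located-face test of `LocatedFace41.lean` (all located faces are products of sub-permutahedra). -/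
theorem permPassenger_three_pow_le {r : ℕ}
    (h : HasEFOfSize (corPolytope n + convexHull ℝ (Set.range (permPt (n := n)))) r) :
    3 ^ (n - 1) ≤ (r + 1) * 2 ^ (n - 1) := by
  refine offDiagConst_univ_three_pow_le h ⟨permPt 1, subset_convexHull ℝ _ ⟨1, rfl⟩⟩ ?_
  -- the hull of off-diagonal-constant generators is off-diagonal-constant: the coordinate functional is affine
  intro y hy y' hy' i _ k _ hik
  have hgen : ∀ z ∈ Set.range (permPt (n := n)), coord i k z = 0 := by
    rintro _ ⟨π, rfl⟩
    rw [permPt, coord_flat, Matrix.diagonal_apply_ne _ hik]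
  have hlin : IsLinearMap ℝ (fun z : Fin (n * n) → ℝ => coord i k z) :=
    ⟨fun u v => rfl, fun c u => rfl⟩
  have hzero : ∀ z ∈ convexHull ℝ (Set.range (permPt (n := n))), coord i k z = 0 := by
    intro z hz
    have hle : coord i k z ≤ 0 :=
      (convexHull_min (fun w hw => (hgen w hw).le) (convex_halfSpace_le hlin 0)) hz
    have hge : 0 ≤ coord i k z :=
      (convexHull_min (fun w hw => (hgen w hw).ge) (convex_halfSpace_ge hlin 0)) hz
    exact le_antisymm hle hge
  rw [hzero y hy, hzero y' hy']

end Summit.ValiantsHypothesis.ValiantsHypothesis.Cruxes.NNDivisionHard.OffDiagShadow41
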